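import Mathlib
import HarnessLib

/-!
# `Σ_{j ≥ 1} binom(j+d−1, d−1)⁻¹ = 1/(d − 2)` for `d ≥ 3` (Levin–Peres–Wilmer, Exercise 10.18)

HONEST FRAMING: exact (Metropolis-corrected) sampling algorithms for lattice gauge theory; figures
of merit are autocorrelation/cost numbers at stated couplings and volumes; no continuum-physics claim.

Source: D. A. Levin, Y. Peres (with E. L. Wilmer), *Markov Chains and Mixing Times*, 2nd ed.,
AMS 2017 [LevinPeres2017], Chapter 10 Exercises, EXERCISE 10.18, verbatim: "Prove that for `d ≥ 3`,
`Σ_{j=1}^{∞} binom(j + d − 1, d − 1)^{−1} = 1/(d − 2)`."  Printed solution (Appendix D): "Write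
`(d − 2)/((j + d − 1)⋯(j + 1)) = 1/((j + 1)⋯(j + d − 2)) − 1/((j + 2)⋯(j + d − 1))`."  (The series
is the one that controls hitting times of the lazy walk on `ℤ^d`-boxes / the `d`-colour urn flow of
§9.5 and Exercise 9.1; the exercise number is cited nowhere else in this directory.)

ROUTE (the printed telescoping, in binomial form).  With `f(j) := binom(j + d − 2, d − 2)^{−1}`
(`= (d−2)!/((j+1)⋯(j+d−2))`) the printed identity reads
`binom(j + d − 1, d − 1)^{−1} = ((d−1)/(d−2))·[f(j) − f(j+1)]` (`inv_choose_telescope`, from the two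
Pascal-type identities `(j+d−1)·binom(j+d−2, d−2) = (d−1)·binom(j+d−1, d−1)` and
`binom(j+d−2, d−2)·(j+d−1) = binom(j+d−1, d−2)·(j+1)` of Mathlib); the partial sums telescope to
`((d−1)/(d−2))·[f(1) − f(N+1)]`, `f(1) = 1/(d−1)` and `0 ≤ f(N+1) ≤ (d−2)/(N+d−1) → 0`.
We write `d = e + 3` (`e ≥ 0`) to keep the arithmetic free of truncated subtraction and index the
series by `j = i + 1`, `i ∈ ℕ`.

* `inv_choose_telescope` — the printed identity, binomial form;
* `inv_choose_le` — `binom(j + e + 1, e + 1)^{−1} ≤ (e+1)/(j + e + 1)` (the tail goes to `0`);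
* **EXERCISE 10.18** `LevinPeres2017_exercise_10_18` (`HasSum` over `i ∈ ℕ` of the term at
  `j = i + 1`, value `1/(e+1) = 1/(d−2)`) and `LevinPeres2017_exercise_10_18_tsum` /
  `LevinPeres2017_exercise_10_18_tsum'` (the `d ≥ 3` phrasing with `d − 1`, `d − 2`).

Everything is PROVED; no definition is introduced.
-/

namespace Literature.Probability.MarkovChains

open Finset Filter Topology

/-- **The printed telescoping identity**, binomial form:
`binom(j+e+2, e+2)⁻¹ = ((e+2)/(e+1))·[binom(j+e+1, e+1)⁻¹ − binom(j+e+2, e+1)⁻¹]` (`d = e + 3`).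
[cite: LevinPeres2017, Chapter 10 Exercise 10.18 (printed solution: "Write
`(d−2)/((j+d−1)⋯(j+1)) = 1/((j+1)⋯(j+d−2)) − 1/((j+2)⋯(j+d−1))`")] -/
theorem inv_choose_telescope (e j : ℕ) :
    (((j + e + 2).choose (e + 2) : ℕ) : ℝ)⁻¹
      = ((e : ℝ) + 2) / ((e : ℝ) + 1)
          * ((((j + e + 1).choose (e + 1) : ℕ) : ℝ)⁻¹ - (((j + e + 2).choose (e + 1) : ℕ) : ℝ)⁻¹) := by
  -- `T` = binom(j+e+2, e+2), `B` = binom(j+e+1, e+1), `B'` = binom(j+e+2, e+1)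
  have hB : 0 < (j + e + 1).choose (e + 1) := Nat.choose_pos (by omega)
  have hB' : 0 < (j + e + 2).choose (e + 1) := Nat.choose_pos (by omega)
  have hT : 0 < (j + e + 2).choose (e + 2) := Nat.choose_pos (by omega)
  -- (i) `(j+e+2)·B = (e+2)·T`
  have h1 : ((j + e + 2 : ℕ) : ℝ) * ((j + e + 1).choose (e + 1) : ℕ)
      = ((j + e + 2).choose (e + 2) : ℕ) * ((e + 2 : ℕ) : ℝ) := by
    -- `(j+e+1+1) * B = T * (e+1+1)`
    have h' : (j + e + 2) * (j + e + 1).choose (e + 1) = (j + e + 2).choose (e + 2) * (e + 2) :=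
      Nat.add_one_mul_choose_eq (j + e + 1) (e + 1)
    exact_mod_cast h'
  -- (ii) `B·(j+e+2) = B'·(j+1)`
  have h2 : (((j + e + 1).choose (e + 1) : ℕ) : ℝ) * ((j + e + 2 : ℕ) : ℝ)
      = ((j + e + 2).choose (e + 1) : ℕ) * ((j + 1 : ℕ) : ℝ) := by
    have := Nat.choose_mul_succ_eq (j + e + 1) (e + 1)
    -- `B * (j+e+2) = B' * (j+e+2-(e+1))`
    have h' : (j + e + 1).choose (e + 1) * (j + e + 2) = (j + e + 2).choose (e + 1) * (j + 1) := by
      rw [this]; congr 1; omega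
    exact_mod_cast h'
  have hBr : (0 : ℝ) < ((j + e + 1).choose (e + 1) : ℕ) := by exact_mod_cast hB
  have hB'r : (0 : ℝ) < ((j + e + 2).choose (e + 1) : ℕ) := by exact_mod_cast hB'
  have hTr : (0 : ℝ) < ((j + e + 2).choose (e + 2) : ℕ) := by exact_mod_cast hT
  have he1 : (0 : ℝ) < (e : ℝ) + 1 := by positivity
  push_cast at h1 h2
  field_simp
  -- both sides are polynomial identities in `T, B, B'` modulo `h1`, `h2`
  nlinarith [h1, h2, hBr, hB'r, hTr]

/-- The tail term is small: `binom(j+e+1, e+1)⁻¹ ≤ (e+1)/(j+e+1)` (from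
`(j+e+1)·binom(j+e, e) = (e+1)·binom(j+e+1, e+1)` and `binom(j+e, e) ≥ 1`).
[cite: LevinPeres2017, Chapter 10 Exercise 10.18 (the telescoping tail)] -/
theorem inv_choose_le (e j : ℕ) :
    (((j + e + 1).choose (e + 1) : ℕ) : ℝ)⁻¹ ≤ ((e : ℝ) + 1) / ((j : ℝ) + e + 1) := by
  -- `(j+e+1) * binom(j+e, e) = binom(j+e+1, e+1) * (e+1)`
  have h' : (j + e + 1) * (j + e).choose e = (j + e + 1).choose (e + 1) * (e + 1) :=
    Nat.add_one_mul_choose_eq (j + e) e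
  have hC : 1 ≤ (j + e).choose e := Nat.choose_pos (by omega)
  have hr : ((j : ℝ) + e + 1) * 1 ≤ (((j + e + 1).choose (e + 1) : ℕ) : ℝ) * ((e : ℝ) + 1) := by
    have h'' : ((j + e + 1 : ℕ) : ℝ) * ((j + e).choose e : ℕ) = ((j + e + 1).choose (e + 1) : ℕ) * ((e + 1 : ℕ) : ℝ) := by
      exact_mod_cast h'
    push_cast at h''
    have hC' : (1 : ℝ) ≤ ((j + e).choose e : ℕ) := by exact_mod_cast hC
    nlinarith
  have hpos : (0 : ℝ) < ((j + e + 1).choose (e + 1) : ℕ) := by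
    exact_mod_cast Nat.choose_pos (by omega)
  have hj : (0 : ℝ) < (j : ℝ) + e + 1 := by positivity
  rw [inv_eq_one_div, div_le_div_iff₀ hpos hj]
  linarith

/-- **EXERCISE 10.18** (`d = e + 3 ≥ 3`, the series indexed by `j = i + 1`, `i ∈ ℕ`):
`Σ_{j ≥ 1} binom(j + d − 1, d − 1)⁻¹ = 1/(d − 2)`, i.e. `Σ_i binom(i + e + 3, e + 2)⁻¹ = 1/(e + 1)`.
[cite: LevinPeres2017, Chapter 10 Exercise 10.18] -/
theorem LevinPeres2017_exercise_10_18 (e : ℕ) :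
    HasSum (fun i : ℕ => (((i + 1 + e + 2).choose (e + 2) : ℕ) : ℝ)⁻¹) (1 / ((e : ℝ) + 1)) := by
  have hnonneg : ∀ i : ℕ, 0 ≤ (((i + 1 + e + 2).choose (e + 2) : ℕ) : ℝ)⁻¹ := fun i => by positivity
  rw [hasSum_iff_tendsto_nat_of_nonneg hnonneg]
  -- the telescoped partial sums
  set f : ℕ → ℝ := fun j => (((j + e + 1).choose (e + 1) : ℕ) : ℝ)⁻¹ with hf
  have hpartial : ∀ N : ℕ, ∑ i ∈ range N, (((i + 1 + e + 2).choose (e + 2) : ℕ) : ℝ)⁻¹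
      = ((e : ℝ) + 2) / ((e : ℝ) + 1) * (f 1 - f (N + 1)) := by
    intro N
    have hterm : ∀ i : ℕ, (((i + 1 + e + 2).choose (e + 2) : ℕ) : ℝ)⁻¹
        = ((e : ℝ) + 2) / ((e : ℝ) + 1) * (f (i + 1) - f (i + 1 + 1)) := by
      intro i
      rw [show i + 1 + e + 2 = (i + 1) + e + 2 by ring, inv_choose_telescope e (i + 1), hf]
      simp only [show i + 1 + 1 + e + 1 = i + 1 + e + 2 by ring]
    simp_rw [hterm]
    rw [← Finset.mul_sum, Finset.sum_range_sub' (fun i => f (i + 1)) N]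
  simp_rw [hpartial]
  -- `f 1 = 1/(e+2)`
  have hf1 : f 1 = 1 / ((e : ℝ) + 2) := by
    rw [hf]
    simp only [show 1 + e + 1 = e + 2 by ring, Nat.choose_succ_self_right]
    push_cast
    rw [inv_eq_one_div]
    ring_nf
  -- `f (N+1) → 0`
  have hf0 : Tendsto (fun N : ℕ => f (N + 1)) atTop (𝓝 0) := by
    have hle : ∀ N : ℕ, f (N + 1) ≤ ((e : ℝ) + 1) / ((N : ℝ) + 1) := by
      intro N
      have h := inv_choose_le e (N + 1)
      rw [hf]
      refine h.trans ?_
      push_cast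
      apply div_le_div_of_nonneg_left (by positivity) (by positivity)
      have : (0 : ℝ) ≤ e := Nat.cast_nonneg e
      linarith
    have hge : ∀ N : ℕ, 0 ≤ f (N + 1) := fun N => by rw [hf]; positivity
    have hlim : Tendsto (fun N : ℕ => ((e : ℝ) + 1) / ((N : ℝ) + 1)) atTop (𝓝 0) := by
      have h1 : Tendsto (fun N : ℕ => ((N : ℝ) + 1)⁻¹) atTop (𝓝 0) := by
        have := tendsto_one_div_add_atTop_nhds_zero_nat (𝕜 := ℝ)
        simpa [one_div] using this
      have h2 := h1.const_mul ((e : ℝ) + 1)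
      rw [mul_zero] at h2
      simpa [div_eq_mul_inv] using h2
    exact squeeze_zero hge hle hlim
  have hlim : Tendsto (fun N : ℕ => ((e : ℝ) + 2) / ((e : ℝ) + 1) * (f 1 - f (N + 1))) atTop
      (𝓝 (((e : ℝ) + 2) / ((e : ℝ) + 1) * (f 1 - 0))) :=
    ((tendsto_const_nhds.sub hf0).const_mul _)
  have he1 : (e : ℝ) + 1 ≠ 0 := by positivity
  have he2 : (e : ℝ) + 2 ≠ 0 := by positivity
  have hval : ((e : ℝ) + 2) / ((e : ℝ) + 1) * (1 / ((e : ℝ) + 2) - 0) = 1 / ((e : ℝ) + 1) := by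
    rw [sub_zero]; field_simp
  rw [hf1] at hlim ⊢
  rw [hval] at hlim
  exact hlim

/-- **EXERCISE 10.18, as printed** (`d ≥ 3`): `Σ_{j=1}^{∞} binom(j + d − 1, d − 1)^{−1} = 1/(d − 2)`, the
series indexed here by `i = j − 1 ∈ ℕ`. [cite: LevinPeres2017, Chapter 10 Exercise 10.18] -/
theorem LevinPeres2017_exercise_10_18_hasSum {d : ℕ} (hd : 3 ≤ d) :
    HasSum (fun i : ℕ => (((i + 1 + d - 1).choose (d - 1) : ℕ) : ℝ)⁻¹) (1 / ((d : ℝ) - 2)) := by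
  obtain ⟨e, rfl⟩ := Nat.exists_eq_add_of_le hd
  have h := LevinPeres2017_exercise_10_18 e
  have h1 : ∀ i : ℕ, i + 1 + (3 + e) - 1 = i + 1 + e + 2 := fun i => by omega
  have h2 : 3 + e - 1 = e + 2 := by omega
  simp_rw [h1, h2]
  convert h using 2
  push_cast; ring

/-- **EXERCISE 10.18, `tsum` form** (`d ≥ 3`): `∑' i, binom(i + d, d − 1)⁻¹ = 1/(d − 2)` (`j = i + 1`).
[cite: LevinPeres2017, Chapter 10 Exercise 10.18] -/
theorem LevinPeres2017_exercise_10_18_tsum {d : ℕ} (hd : 3 ≤ d) :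
    ∑' i : ℕ, (((i + d).choose (d - 1) : ℕ) : ℝ)⁻¹ = 1 / ((d : ℝ) - 2) := by
  have h := (LevinPeres2017_exercise_10_18_hasSum hd).tsum_eq
  have h1 : ∀ i : ℕ, i + 1 + d - 1 = i + d := fun i => by omega
  simp_rw [h1] at h
  exact h

end Literature.Probability.MarkovChains
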